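import Mathlib
import Literature.LinearAlgebra.Matrix.CharpolySignAlternation
import Literature.Combinatorics.Optimization.PsdLiftSlackMatrix
import Literature.Combinatorics.Optimization.PolytopePsdRankLowerBound
import Literature.NumberTheory.Transcendental.SemialgebraicMapsProofs
import Literature.AlgebraicGeometry.RealAlgebraic.QuantifierEliminationComplexity
import HarnessLib

/-!
# The algebraic boundary of a set with a psd lift (FGPRT 2015, §5.2: Proposition 5.12, Corollary 5.13)

Sources. H. Fawzi, J. Gouveia, P. A. Parrilo, R. Z. Robinson, R. R. Thomas, *Positive semidefinite
rank*, Math. Program. 153 (2015) 133–177 = arXiv:1407.4095 [FawziEtAl2015], §5.2 (held text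
`paper:arxiv-1407.4095`, p0016): Theorem 5.10 (Renegar: a spectrahedron with a positive definite
point is `{g^{(i)} ≥ 0, i < k}`, `k` polynomials of degree `≤ k`), Theorem 5.11 (Renegar's
quantifier elimination with degree bounds — the tree's NAMED FACT
`Literature.AlgebraicGeometry.RealAlgebraic.Renegar1992_qeExistentialBlock`), Proposition 5.12
("If `C ⊆ ℝⁿ` is a full-dimensional convex semialgebraic set with a `S^k_+`-lift, then the degree of
`C` is at most `k^{O(k²n)}`") and Corollary 5.13 (a full-dimensional polytope whose slack matrix has
psd rank `k` has at most `k^{O(k²n)}` facets); the proofs are those of J. Gouveia, P. Parrilo,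
R. Thomas, *Lifts of convex sets and cone factorizations*, Math. OR 38 (2013) [GouveiaParriloThomas2013],
Prop. 4.17 / Cor. 4.18 (held `paper:arxiv-1111.3164`, p0014): parametrise the affine space of the
lift as `L = {A_0 + Σ x_i A_i + Σ y_j B_j}` with `π = (x_1, …, x_n)`, describe
`Q = {(x,y) : A_0 + Σ x_i A_i + Σ y_j B_j ⪰ 0}` by `k` polynomial inequalities of degree `≤ k`,
eliminate `y` (Theorem 5.11) and multiply the resulting polynomials.

Contents (everything PROVED; the only named fact used is Renegar's Theorem 5.11, as a hypothesis of
the two `_of_qe` theorems).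
* §1 `exists_charpoly_coeff_polynomials`, `exists_polynomials_posSemidef_pencil_iff`: for symmetric
  `M₀, B_t` the set `{w : M₀ + Σ_t w_t B_t ⪰ 0}` is `{w : g_i(w) ≥ 0, i < k}` with `deg g_i ≤ k`,
  `g_i = (−1)^{k−i} coeff_i` of the characteristic polynomial — the tree's sign test
  `Literature.LinearAlgebra.Matrix.CharpolySignAlternation.posSemidef_iff_sign_mul_charpoly_coeff_nonneg_real`
  (Horn–Johnson Cor. 7.2.4). DEVIATION from the printed proof: this replaces the Renegar derivatives
  of Theorem 5.10, which need a positive definite point of `L`, so the reduction "we may assume that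
  `C` has a proper `S^k_+`-lift" is not needed; the count (`k` polynomials of degree `≤ k`) is the same.
* §2 `HasPsdLift.exists_affine_coordinates` (`C = {π M₀ + Λw : M₀ + Σ w_t B_t ⪰ 0}`, `N ≤ k²`
  coordinates on the symmetric part of `L`), `HasPsdLift.exists_eq_image_projection` (for `int C ≠ ∅`
  the linear part is onto, and in adapted coordinates `C = a₀ + {x : ∃ u ∈ ℝ^m, g_i(x,u) ≥ 0}` with
  `1 ≤ m ≤ k² + 1`, `n ≤ k²`, `deg g_i ≤ k`).
* §3 `HasPsdLift.isSemialgebraic`: every set with a psd lift is `ℝ`-semialgebraic (by the tree's proved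
  Tarski–Seidenberg theorem, `IsSemialgebraic.image_castAdd`), and the UNCONDITIONAL qualitative form of
  Proposition 5.12, `HasPsdLift.exists_ne_zero_eval_eq_zero_of_mem_frontier`: the boundary of a set
  with a psd lift lies in the zero set of a nonzero polynomial
  (`IsSemialgebraic.exists_frontier_subset_zeroLocus`).
* §4 `FawziEtAl2015_prop512_of_qe : Renegar1992_qeExistentialBlock → FawziEtAl2015_prop512` (with
  the constant `c = 12K + 1`, `K` Renegar's constant: degree `≤ (k²)^{K(n+2)m} ≤ k^{12Kk²n}`; the cases
  `n = 0` and `k = 1` — then `C` is `ℝ⁰`, a line or a ray — are done by hand) and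
  `FawziEtAl2015_cor513_of_qe : Renegar1992_qeExistentialBlock → FawziEtAl2015_cor513` (through the
  tree's `FawziEtAl2015_cor513_of_prop512`). So both named facts of the survey's §5.2 now rest on
  Renegar's quantifier elimination alone.

NOT here: Theorem 5.10 itself (Renegar derivatives in a direction `E ≻ 0`); Examples 5.14–5.15.
-/

noncomputable section

open Matrix MvPolynomial Finset Set
open scoped BigOperators Polynomial

namespace Literature.Combinatorics.Optimization

open Literature.LinearAlgebra.Matrix.CharpolySignAlternation
  (posSemidef_iff_sign_mul_charpoly_coeff_nonneg_real)
open Literature.LinearAlgebra.Matrix (charpoly_coeff_card natDegree_charpoly_le)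

/-! ### §1 The coefficients of the characteristic polynomial of an affine symmetric pencil -/

section Pencil

variable {k N : ℕ}

/-- The determinant of a square matrix of polynomials of total degree `≤ 1` has total degree at
most the size of the matrix (expand over permutations). [folklore] -/
private theorem totalDegree_det_le_card {σ : Type*} {ι : Type*} [Fintype ι] [DecidableEq ι]
    (A : Matrix ι ι (MvPolynomial σ ℝ)) (hA : ∀ i j, (A i j).totalDegree ≤ 1) :
    A.det.totalDegree ≤ Fintype.card ι := by
  rw [Matrix.det_apply']
  refine totalDegree_finsetSum_le fun τ _ => ?_
  calc (((Equiv.Perm.sign τ : ℤ) : MvPolynomial σ ℝ) * ∏ i, A (τ i) i).totalDegree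
      ≤ ((Equiv.Perm.sign τ : ℤ) : MvPolynomial σ ℝ).totalDegree +
          (∏ i, A (τ i) i).totalDegree := totalDegree_mul _ _
    _ ≤ 0 + ∑ i, (A (τ i) i).totalDegree := by
        refine add_le_add (le_of_eq ?_) (totalDegree_finsetProd _ _)
        rw [← map_intCast (C : ℝ →+* MvPolynomial σ ℝ), totalDegree_C]
    _ ≤ 0 + ∑ _i : ι, 1 := by
        exact add_le_add le_rfl (Finset.sum_le_sum fun i _ => hA _ _)
    _ = Fintype.card ι := by simp [Finset.card_univ]

/-- The value of the characteristic polynomial of a real matrix at a real point is the determinant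
`det(t I − Y)`. [folklore] -/
private theorem eval_charpoly_eq_det {ι : Type*} [Fintype ι] [DecidableEq ι]
    (Y : Matrix ι ι ℝ) (t : ℝ) :
    Y.charpoly.eval t = (Matrix.scalar ι t - Y).det :=
  Matrix.eval_charpoly Y t

/-- **The characteristic coefficients of an affine matrix pencil are polynomials of degree `≤ k`.**
For `k × k` real matrices `M₀, B_1, …, B_N` there are polynomials `c_i ∈ ℝ[w_1, …, w_N]` of total
degree `≤ k` with `c_i(w) = coeff_i det(tI − (M₀ + Σ_t w_t B_t))` for every `w ∈ ℝ^N` and every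
`i` (the coefficient of `t^i` of the determinant of the symbolic matrix
`t I − M₀ − Σ_t w_t B_t`, whose entries are affine in `(t, w)`). This is the observation
"`L ∩ S^k_+` is a semialgebraic set where the bounding polynomials have degree at most `k`".
[cite: FawziEtAl2015, §5.2 before Thm 5.10 (p16)] -/
theorem exists_charpoly_coeff_polynomials (M₀ : Matrix (Fin k) (Fin k) ℝ)
    (B : Fin N → Matrix (Fin k) (Fin k) ℝ) :
    ∃ c : ℕ → MvPolynomial (Fin N) ℝ, (∀ i, (c i).totalDegree ≤ k) ∧
      ∀ (w : Fin N → ℝ) (i : ℕ), eval w (c i) = (M₀ + ∑ t, w t • B t).charpoly.coeff i := by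
  classical
  -- the symbolic characteristic matrix over `ℝ[X_0, X_1, …, X_N]` (`X_0 ↔ t`, `X_{t+1} ↔ w_t`)
  let A : Matrix (Fin k) (Fin k) (MvPolynomial (Fin (N + 1)) ℝ) := Matrix.of fun a b =>
    (if a = b then X 0 else 0) - C (M₀ a b) - ∑ t, X (Fin.succ t) * C (B t a b)
  let D : MvPolynomial (Fin (N + 1)) ℝ := A.det
  have hA : ∀ a b, (A a b).totalDegree ≤ 1 := by
    intro a b
    simp only [A, Matrix.of_apply]
    refine (totalDegree_sub _ _).trans (max_le ((totalDegree_sub _ _).trans (max_le ?_ ?_)) ?_)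
    · split_ifs
      · exact (totalDegree_X (R := ℝ) (0 : Fin (N + 1))).le
      · simp
    · simp
    · refine totalDegree_finsetSum_le fun t _ => (totalDegree_mul _ _).trans ?_
      rw [totalDegree_C, add_zero]
      exact (totalDegree_X (R := ℝ) (Fin.succ t)).le
  have hD : D.totalDegree ≤ k := by
    simpa using totalDegree_det_le_card A hA
  refine ⟨fun i => ((finSuccEquiv ℝ N) D).coeff i, fun i => ?_, fun w i => ?_⟩
  · show (((finSuccEquiv ℝ N) D).coeff i).totalDegree ≤ k
    by_cases hci : ((finSuccEquiv ℝ N) D).coeff i = 0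
    · simp only [hci, totalDegree_zero, Nat.zero_le]
    · have h := totalDegree_coeff_finSuccEquiv_add_le D i hci
      omega
  · set Y : Matrix (Fin k) (Fin k) ℝ := M₀ + ∑ t, w t • B t with hY
    -- the specialised polynomial `t ↦ D(t, w)` is the characteristic polynomial of `Y`
    have hpeval : ∀ t : ℝ, (Polynomial.map (eval w) ((finSuccEquiv ℝ N) D)).eval t =
        Y.charpoly.eval t := by
      intro t
      rw [← eval_eq_eval_mv_eval', eval_charpoly_eq_det,
        show eval (Fin.cons t w) D = ((eval (Fin.cons t w)).mapMatrix A).det from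
          RingHom.map_det (eval (Fin.cons t w)) A]
      congr 1
      ext a b
      simp only [RingHom.mapMatrix_apply, Matrix.map_apply, A, Matrix.of_apply, map_sub, map_sum,
        map_mul, eval_C, eval_X, Fin.cons_succ, hY, Matrix.sub_apply, Matrix.smul_apply,
        Matrix.scalar_apply, Matrix.diagonal_apply, Matrix.add_apply, Matrix.sum_apply, smul_eq_mul]
      split_ifs with hab
      · simp only [eval_X, Fin.cons_zero]
        ring
      · simp only [map_zero]
        ring
    have hp : Polynomial.map (eval w) ((finSuccEquiv ℝ N) D) = Y.charpoly :=
      Polynomial.funext hpeval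
    rw [← hp, Polynomial.coeff_map]

/-- **Positive semidefiniteness on a symmetric pencil is cut out by `k` polynomial inequalities of
degree `≤ k`.** For symmetric `k × k` matrices `M₀, B_1, …, B_N` there are `g_0, …, g_{k−1} ∈
ℝ[w_1, …, w_N]` of total degree `≤ k` with `M₀ + Σ_t w_t B_t ⪰ 0 ⟺ g_i(w) ≥ 0` for all `i`:
`g_i = (−1)^{k−i} coeff_i` of the characteristic polynomial (the tree's coefficient sign test
`posSemidef_iff_sign_mul_charpoly_coeff_nonneg_real`, Horn–Johnson Cor. 7.2.4; the coefficient of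
`t^k` is `1`). Used in place of the `k` Renegar derivatives `g^{(i)}` of [FawziEtAl2015, Thm 5.10],
which need a positive definite point of the pencil. [cite: FawziEtAl2015, §5.2 Thm 5.10 (p16)] -/
theorem exists_polynomials_posSemidef_pencil_iff {M₀ : Matrix (Fin k) (Fin k) ℝ}
    {B : Fin N → Matrix (Fin k) (Fin k) ℝ} (hM₀ : M₀.IsSymm) (hB : ∀ t, (B t).IsSymm) :
    ∃ g : Fin k → MvPolynomial (Fin N) ℝ, (∀ i, (g i).totalDegree ≤ k) ∧
      ∀ w : Fin N → ℝ, (M₀ + ∑ t, w t • B t).PosSemidef ↔ ∀ i, 0 ≤ eval w (g i) := by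
  classical
  obtain ⟨c, hcdeg, hc⟩ := exists_charpoly_coeff_polynomials M₀ B
  refine ⟨fun i => C ((-1 : ℝ) ^ (k - i)) * c i, fun i => ?_, fun w => ?_⟩
  · exact (totalDegree_mul _ _).trans (by rw [totalDegree_C, zero_add]; exact hcdeg i)
  · have hYs : (M₀ + ∑ t, w t • B t).IsSymm := by
      have h2 : (∑ t, w t • B t).IsSymm := by
        unfold Matrix.IsSymm
        rw [Matrix.transpose_sum]
        exact Finset.sum_congr rfl fun t _ => by rw [Matrix.transpose_smul, (hB t).eq]
      exact hM₀.add h2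
    rw [posSemidef_iff_sign_mul_charpoly_coeff_nonneg_real hYs, Fintype.card_fin]
    constructor
    · intro h i
      rw [map_mul, eval_C, hc]
      exact h i
    · intro h j
      by_cases hj : j < k
      · have := h ⟨j, hj⟩
        rwa [map_mul, eval_C, hc] at this
      · rcases (not_lt.1 hj).eq_or_lt with rfl | hlt
        · have hcard := charpoly_coeff_card (M₀ + ∑ t, w t • B t)
          rw [Fintype.card_fin] at hcard
          rw [hcard, Nat.sub_self, pow_zero, one_mul]
          exact zero_le_one
        · have hdeg := natDegree_charpoly_le (M₀ + ∑ t, w t • B t)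
          rw [Fintype.card_fin] at hdeg
          rw [Polynomial.coeff_eq_zero_of_natDegree_lt (hdeg.trans_lt hlt), mul_zero]

end Pencil

/-! ### §2 Affine coordinates on a psd lift -/

section Coordinates

variable {n k : ℕ}

/-- A real positive semidefinite matrix is symmetric. [folklore] -/
private theorem isSymm_of_posSemidef {ι : Type*} {M : Matrix ι ι ℝ} (hM : M.PosSemidef) :
    M.IsSymm := by
  have h := hM.1
  rw [Matrix.IsHermitian, Matrix.conjTranspose_eq_transpose_of_trivial] at h
  exact h

/-- **Affine coordinates on a psd lift.** If `C = π(S^k_+ ∩ L)` (`L` affine, `π` linear) is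
nonempty, then, with `M₀ ∈ S^k_+ ∩ L` and a basis `B_1, …, B_N` (`N ≤ k²`) of the symmetric part of
the direction of `L`, `C = {π(M₀) + Λ w : w ∈ ℝ^N, M₀ + Σ_t w_t B_t ⪰ 0}` with `Λ w = Σ_t w_t π(B_t)`
linear — the parametrisation "`L = {A_0 + Σ x_i A_i + Σ y_j B_j}`" of the printed proof.
[cite: GouveiaParriloThomas2013, Prop. 4.17 (proof)] -/
theorem HasPsdLift.exists_affine_coordinates {C : Set (Fin n → ℝ)} (h : HasPsdLift C k)
    (hne : C.Nonempty) :
    ∃ (N : ℕ) (a₀ : Fin n → ℝ) (Λ : (Fin N → ℝ) →ₗ[ℝ] (Fin n → ℝ)) (M₀ : Matrix (Fin k) (Fin k) ℝ)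
      (B : Fin N → Matrix (Fin k) (Fin k) ℝ), N ≤ k ^ 2 ∧ M₀.IsSymm ∧ (∀ t, (B t).IsSymm) ∧
      C = (fun w => a₀ + Λ w) '' {w | (M₀ + ∑ t, w t • B t).PosSemidef} := by
  classical
  obtain ⟨L, π, rfl⟩ := h
  obtain ⟨-, M₁, ⟨hM₁, hM₁L⟩, -⟩ := hne
  -- the symmetric part of the direction of `L`
  let D : Submodule ℝ (Matrix (Fin k) (Fin k) ℝ) :=
    { carrier := {v | v ∈ L.direction ∧ vᵀ = v}
      add_mem' := fun {a b} ha hb =>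
        ⟨L.direction.add_mem ha.1 hb.1, by rw [Matrix.transpose_add, ha.2, hb.2]⟩
      zero_mem' := ⟨L.direction.zero_mem, Matrix.transpose_zero⟩
      smul_mem' := fun c {v} hv =>
        ⟨L.direction.smul_mem c hv.1, by rw [Matrix.transpose_smul, hv.2]⟩ }
  have hDmem : ∀ v, v ∈ D ↔ v ∈ L.direction ∧ vᵀ = v := fun v => Iff.rfl
  let b : Module.Basis (Fin (Module.finrank ℝ D)) ℝ D := Module.finBasis ℝ D
  let B : Fin (Module.finrank ℝ D) → Matrix (Fin k) (Fin k) ℝ := fun t => (b t : Matrix (Fin k) (Fin k) ℝ)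
  let β : (Fin (Module.finrank ℝ D) → ℝ) →ₗ[ℝ] Matrix (Fin k) (Fin k) ℝ :=
    { toFun := fun w => ∑ t, w t • B t
      map_add' := fun w w' => by
        simp only [Pi.add_apply, add_smul, Finset.sum_add_distrib]
      map_smul' := fun c w => by
        simp only [Pi.smul_apply, smul_eq_mul, RingHom.id_apply, Finset.smul_sum, smul_smul] }
  have hβ : ∀ w, β w = ∑ t, w t • B t := fun w => rfl
  have hM₁s : M₁.IsSymm := isSymm_of_posSemidef hM₁
  have hBdir : ∀ t, B t ∈ L.direction := fun t => ((hDmem _).1 (b t).2).1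
  refine ⟨Module.finrank ℝ D, π M₁, π ∘ₗ β, M₁, B, ?_, hM₁s, fun t => ((hDmem _).1 (b t).2).2, ?_⟩
  · calc Module.finrank ℝ D ≤ Module.finrank ℝ (Matrix (Fin k) (Fin k) ℝ) := Submodule.finrank_le D
      _ = k ^ 2 := by simp [Module.finrank_matrix, sq]
  · ext x
    simp only [Set.mem_image, Set.mem_setOf_eq, LinearMap.coe_comp, Function.comp_apply]
    constructor
    · rintro ⟨M, ⟨hM, hML⟩, rfl⟩
      have hv : M - M₁ ∈ D := (hDmem _).2 ⟨AffineSubspace.vsub_mem_direction hML hM₁L, by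
        rw [Matrix.transpose_sub, (isSymm_of_posSemidef hM).eq, hM₁s.eq]⟩
      have hsum : ∑ t, (b.repr ⟨M - M₁, hv⟩) t • B t = M - M₁ := by
        have h1 := congrArg Subtype.val (b.sum_repr ⟨M - M₁, hv⟩)
        rw [Submodule.coe_sum] at h1
        simpa only [Submodule.coe_smul] using h1
      refine ⟨b.repr ⟨M - M₁, hv⟩, ?_, ?_⟩
      · rw [hsum, add_sub_cancel]
        exact hM
      · rw [hβ, hsum, ← map_add, add_sub_cancel]
    · rintro ⟨w, hw, rfl⟩
      have hdir : ∑ t, w t • B t ∈ L.direction :=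
        L.direction.sum_mem fun t _ => L.direction.smul_mem _ (hBdir t)
      refine ⟨M₁ + ∑ t, w t • B t, ⟨hw, ?_⟩, by rw [map_add, hβ]⟩
      have h1 := AffineSubspace.vadd_mem_of_mem_direction hdir hM₁L
      rwa [vadd_eq_add, add_comm] at h1

/-- **Full-dimensionality makes the projection surjective**: if `{a₀ + Λ w : w ∈ S}` has nonempty
interior in `ℝⁿ` for a linear `Λ : ℝ^N → ℝⁿ`, then `Λ` is onto (its range is a subspace whose
translate has interior, hence is everything). [folklore] -/
private theorem surjective_of_nonempty_interior_image {N : ℕ} (a₀ : Fin n → ℝ)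
    (Λ : (Fin N → ℝ) →ₗ[ℝ] (Fin n → ℝ)) (S : Set (Fin N → ℝ))
    (hint : (interior ((fun w => a₀ + Λ w) '' S)).Nonempty) : Function.Surjective Λ := by
  have hsub : (fun w => a₀ + Λ w) '' S ⊆
      (Homeomorph.addLeft a₀) '' (LinearMap.range Λ : Set (Fin n → ℝ)) := by
    rintro _ ⟨w, -, rfl⟩
    exact ⟨Λ w, LinearMap.mem_range_self Λ w, rfl⟩
  have h1 : (interior ((Homeomorph.addLeft a₀) '' (LinearMap.range Λ : Set (Fin n → ℝ)))).Nonempty :=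
    hint.mono (interior_mono hsub)
  rw [← Homeomorph.image_interior, Set.image_nonempty] at h1
  exact LinearMap.range_eq_top.1 ((LinearMap.range Λ).eq_top_of_nonempty_interior' h1)

/-- **Coordinates adapted to a surjection.** For a linear surjection `Λ : ℝ^N → ℝⁿ` there are
linear `R : ℝⁿ → ℝ^N` (a section) and `κ : ℝ^m → ℝ^N` (onto `ker Λ`, `1 ≤ m ≤ N + 1`) with
`Λ(Rx + κu) = x` and every `w` of the form `R(Λw) + κu`; in particular `n ≤ N` — the change of
coordinates "`π(A_0 + Σ x_i A_i + Σ y_j B_j) = (x_1, …, x_n)`" of the printed proof. [folklore] -/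
private theorem exists_fibre_coordinates {N : ℕ} (Λ : (Fin N → ℝ) →ₗ[ℝ] (Fin n → ℝ))
    (hΛ : Function.Surjective Λ) :
    ∃ (m : ℕ) (R : (Fin n → ℝ) →ₗ[ℝ] (Fin N → ℝ)) (κ : (Fin m → ℝ) →ₗ[ℝ] (Fin N → ℝ)),
      1 ≤ m ∧ m ≤ N + 1 ∧ n ≤ N ∧ (∀ x u, Λ (R x + κ u) = x) ∧ ∀ w, ∃ u, R (Λ w) + κ u = w := by
  classical
  obtain ⟨R, hR⟩ := Λ.exists_rightInverse_of_surjective (LinearMap.range_eq_top.2 hΛ)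
  have hRx : ∀ x, Λ (R x) = x := fun x => by
    have := LinearMap.congr_fun hR x
    simpa using this
  let K : Submodule ℝ (Fin N → ℝ) := LinearMap.ker Λ
  let bK : Module.Basis (Fin (Module.finrank ℝ K)) ℝ K := Module.finBasis ℝ K
  let κ : (Fin (Module.finrank ℝ K + 1) → ℝ) →ₗ[ℝ] (Fin N → ℝ) :=
    { toFun := fun u => ∑ j : Fin (Module.finrank ℝ K), u (Fin.castSucc j) • (bK j : Fin N → ℝ)
      map_add' := fun u u' => by
        simp only [Pi.add_apply, add_smul, Finset.sum_add_distrib]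
      map_smul' := fun c u => by
        simp only [Pi.smul_apply, smul_eq_mul, RingHom.id_apply, Finset.smul_sum, smul_smul] }
  have hκ : ∀ u, κ u = ∑ j : Fin (Module.finrank ℝ K), u (Fin.castSucc j) • (bK j : Fin N → ℝ) :=
    fun u => rfl
  refine ⟨Module.finrank ℝ K + 1, R, κ, by omega, ?_, ?_, ?_, ?_⟩
  · have h1 : Module.finrank ℝ K ≤ Module.finrank ℝ (Fin N → ℝ) := Submodule.finrank_le K
    rw [Module.finrank_fin_fun] at h1
    omega
  · have h1 := LinearMap.finrank_range_le Λ
    rw [LinearMap.range_eq_top.2 hΛ, finrank_top, Module.finrank_fin_fun,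
      Module.finrank_fin_fun] at h1
    exact h1
  · intro x u
    have hκ0 : Λ (κ u) = 0 := by
      rw [hκ, map_sum]
      exact Finset.sum_eq_zero fun j _ => by rw [map_smul, LinearMap.mem_ker.1 (bK j).2, smul_zero]
    rw [map_add, hRx, hκ0, add_zero]
  · intro w
    have hv : w - R (Λ w) ∈ K := by
      rw [LinearMap.mem_ker, map_sub, hRx, sub_self]
    refine ⟨Fin.snoc (fun j => bK.repr ⟨w - R (Λ w), hv⟩ j) 0, ?_⟩
    have hsum : ∑ j, (bK.repr ⟨w - R (Λ w), hv⟩) j • (bK j : Fin N → ℝ) = w - R (Λ w) := by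
      have h1 := congrArg Subtype.val (bK.sum_repr ⟨w - R (Λ w), hv⟩)
      rw [Submodule.coe_sum] at h1
      simpa only [Submodule.coe_smul] using h1
    rw [hκ]
    simp only [Fin.snoc_castSucc]
    rw [hsum, add_sub_cancel]

/-- Linear reindexing of a pencil: `Σ_t (F x)_t B_t = Σ_l x_l (Σ_t (F e_l)_t B_t)`. [folklore] -/
private theorem sum_apply_smul_eq_sum_smul {N p : ℕ} (F : (Fin p → ℝ) →ₗ[ℝ] (Fin N → ℝ))
    (B : Fin N → Matrix (Fin k) (Fin k) ℝ) (x : Fin p → ℝ) :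
    ∑ t, (F x) t • B t = ∑ l, x l • ∑ t, (F fun j => if l = j then 1 else 0) t • B t := by
  conv_lhs => rw [LinearMap.pi_apply_eq_sum_univ F x]
  simp only [Finset.sum_apply, Pi.smul_apply, smul_eq_mul, Finset.sum_smul, Finset.smul_sum,
    smul_smul]
  rw [Finset.sum_comm]

/-- **A full-dimensional psd lift is a coordinate projection of a set cut out by `k` polynomial
inequalities of degree `≤ k` in `≤ n + k² + 1` variables.** If `C ⊆ ℝⁿ` has a psd lift of size `k`
and nonempty interior, then `n ≤ k²` and there are `1 ≤ m ≤ k² + 1`, `a₀ ∈ ℝⁿ` and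
`g_0, …, g_{k−1} ∈ ℝ[x_1..x_n, u_1..u_m]` of degree `≤ k` with
`C = a₀ + {x : ∃ u, g_i(x,u) ≥ 0 ∀ i}` — the set `Q = {(x,y) : A_0 + Σ x_i A_i + Σ y_j B_j ⪰ 0}`
"cut out by `k` … polynomial inequalities of degree at most `k`" with `π(Q) = C` of the printed
proof (coefficient sign test in place of Renegar derivatives, so no properness of the lift is
needed). [cite: GouveiaParriloThomas2013, Prop. 4.17 (proof)] -/
theorem HasPsdLift.exists_eq_image_projection {C : Set (Fin n → ℝ)} (h : HasPsdLift C k)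
    (hint : (interior C).Nonempty) :
    ∃ (m : ℕ) (a₀ : Fin n → ℝ) (g : Fin k → MvPolynomial (Fin (n + m)) ℝ),
      1 ≤ m ∧ m ≤ k ^ 2 + 1 ∧ n ≤ k ^ 2 ∧ (∀ i, (g i).totalDegree ≤ k) ∧
      C = (fun x => a₀ + x) '' {x | ∃ u : Fin m → ℝ, ∀ i, 0 ≤ eval (Fin.append x u) (g i)} := by
  classical
  have hne : C.Nonempty := hint.mono interior_subset
  obtain ⟨N, a₀, Λ, M₀, B, hN, hM₀, hB, hC⟩ := h.exists_affine_coordinates hne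
  have hΛ : Function.Surjective Λ :=
    surjective_of_nonempty_interior_image a₀ Λ _ (hC ▸ hint)
  obtain ⟨m, R, κ, hm1, hmN, hnN, hΛRκ, hfib⟩ := exists_fibre_coordinates Λ hΛ
  -- the pencil in the coordinates `(x, u)`
  let P : Fin n → Matrix (Fin k) (Fin k) ℝ := fun l =>
    ∑ t, (R fun j => if l = j then 1 else 0) t • B t
  let Q : Fin m → Matrix (Fin k) (Fin k) ℝ := fun j =>
    ∑ t, (κ fun j' => if j = j' then 1 else 0) t • B t
  let Bc : Fin (n + m) → Matrix (Fin k) (Fin k) ℝ := Fin.append P Q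
  have hsymm_sum : ∀ c : Fin N → ℝ, (∑ t, c t • B t).IsSymm := fun c => by
    unfold Matrix.IsSymm
    rw [Matrix.transpose_sum]
    exact Finset.sum_congr rfl fun t _ => by rw [Matrix.transpose_smul, (hB t).eq]
  have hBc : ∀ r, (Bc r).IsSymm := by
    intro r
    refine Fin.addCases (fun l => ?_) (fun j => ?_) r
    · simp only [Bc, Fin.append_left, P]; exact hsymm_sum _
    · simp only [Bc, Fin.append_right, Q]; exact hsymm_sum _
  obtain ⟨g, hgdeg, hg⟩ := exists_polynomials_posSemidef_pencil_iff hM₀ hBc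
  -- the pencil identity `M₀ + Σ_r (x,u)_r Bc_r = M₀ + Σ_t (Rx + κu)_t B_t`
  have hpencil : ∀ (x : Fin n → ℝ) (u : Fin m → ℝ),
      M₀ + ∑ r, Fin.append x u r • Bc r = M₀ + ∑ t, (R x + κ u) t • B t := by
    intro x u
    congr 1
    rw [Fin.sum_univ_add]
    simp only [Bc, Fin.append_left, Fin.append_right]
    have h1 : ∑ t, (R x + κ u) t • B t = ∑ t, (R x) t • B t + ∑ t, (κ u) t • B t := by
      rw [← Finset.sum_add_distrib]
      exact Finset.sum_congr rfl fun t _ => by rw [Pi.add_apply, add_smul]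
    rw [h1, sum_apply_smul_eq_sum_smul R B x, sum_apply_smul_eq_sum_smul κ B u]
  refine ⟨m, a₀, g, hm1, by nlinarith [hmN, hN], hnN.trans hN, hgdeg, ?_⟩
  rw [hC]
  ext y
  simp only [Set.mem_image, Set.mem_setOf_eq]
  constructor
  · rintro ⟨w, hw, rfl⟩
    obtain ⟨u, hu⟩ := hfib w
    refine ⟨Λ w, ⟨u, ?_⟩, rfl⟩
    rw [← hg, hpencil, hu]
    exact hw
  · rintro ⟨x, ⟨u, hu⟩, rfl⟩
    refine ⟨R x + κ u, ?_, by rw [hΛRκ]⟩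
    rw [← hpencil, hg]
    exact hu

end Coordinates

/-! ### §3 Psd lifts are semialgebraic; the boundary lies on a hypersurface -/

section Semialgebraic

variable {n k : ℕ}

open Literature.ModelTheory.ExponentialFields (IsSemialgebraic isSemialgebraic_empty
  isSemialgebraic_setOf_eval_nonneg isSemialgebraic_setOf_eval_eq_zero)

/-- Over `ℝ` as its own coefficient ring, `aeval` is `eval`. [folklore] -/
private theorem aeval_eq_eval_real {σ : Type*} (v : σ → ℝ) (p : MvPolynomial σ ℝ) :
    aeval v p = eval v p := rfl

/-- **Sets with a psd lift are semialgebraic** ("`L ∩ S^k_+` is a semialgebraic set … Since `C` is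
the projection of `Q`, by the Tarski–Seidenberg transfer principle, `C` is again semialgebraic"):
every `C = π(S^k_+ ∩ L) ⊆ ℝⁿ` is an `ℝ`-semialgebraic set — the projection to the first `n`
coordinates of `{(x, w) : g_i(w) ≥ 0, x = π(M₀) + Λ w} ⊆ ℝ^{n+N}`, by the tree's (proved)
Tarski–Seidenberg theorem `IsSemialgebraic.image_castAdd`.
[cite: GouveiaParriloThomas2013, Prop. 4.17 (proof)] -/
theorem HasPsdLift.isSemialgebraic {S : Set (Fin n → ℝ)} (h : HasPsdLift S k) :
    IsSemialgebraic ℝ S := by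
  classical
  rcases S.eq_empty_or_nonempty with rfl | hne
  · exact isSemialgebraic_empty
  obtain ⟨N, a₀, Λ, M₀, B, -, hM₀, hB, hS⟩ := h.exists_affine_coordinates hne
  obtain ⟨g, -, hg⟩ := exists_polynomials_posSemidef_pencil_iff hM₀ hB
  let e : Fin N → (Fin N → ℝ) := fun t j => if t = j then 1 else 0
  let q : Fin n → MvPolynomial (Fin (n + N)) ℝ := fun l =>
    X (Fin.castAdd N l) - C (a₀ l) - ∑ t, C (Λ (e t) l) * X (Fin.natAdd n t)
  let W : Set (Fin (n + N) → ℝ) :=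
    (⋂ i ∈ (Finset.univ : Finset (Fin k)), {v | 0 ≤ aeval v (rename (Fin.natAdd n) (g i))}) ∩
      ⋂ l ∈ (Finset.univ : Finset (Fin n)), {v | aeval v (q l) = 0}
  have hW : IsSemialgebraic ℝ W :=
    (IsSemialgebraic.biInter _ _ fun i _ => isSemialgebraic_setOf_eval_nonneg _).inter
      (IsSemialgebraic.biInter _ _ fun l _ => isSemialgebraic_setOf_eval_eq_zero _)
  have hΛe : ∀ (w : Fin N → ℝ) (l : Fin n), Λ w l = ∑ t, Λ (e t) l * w t := by
    intro w l
    rw [LinearMap.pi_apply_eq_sum_univ Λ w, Finset.sum_apply]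
    exact Finset.sum_congr rfl fun t _ => by simp only [Pi.smul_apply, smul_eq_mul, mul_comm, e]
  have hq : ∀ (v : Fin (n + N) → ℝ) (l : Fin n), aeval v (q l) =
      v (Fin.castAdd N l) - a₀ l - ∑ t, Λ (e t) l * v (Fin.natAdd n t) := by
    intro v l
    rw [aeval_eq_eval_real]
    simp only [q, map_sub, map_sum, map_mul, eval_X, eval_C]
  have hgr : ∀ (v : Fin (n + N) → ℝ) (i : Fin k), aeval v (rename (Fin.natAdd n) (g i)) =
      eval (v ∘ Fin.natAdd n) (g i) := by
    intro v i
    rw [aeval_rename, aeval_eq_eval_real]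
  have hSW : S = (fun w : Fin (n + N) → ℝ => fun i : Fin n => w (Fin.castAdd N i)) '' W := by
    rw [hS]
    ext x
    constructor
    · rintro ⟨w, hw, rfl⟩
      refine ⟨Fin.append (a₀ + Λ w) w,
        ⟨Set.mem_iInter₂.2 fun i _ => ?_, Set.mem_iInter₂.2 fun l _ => ?_⟩, ?_⟩
      · rw [Set.mem_setOf_eq, hgr]
        have hcomp : Fin.append (a₀ + Λ w) w ∘ Fin.natAdd n = w := by
          funext t; simp only [Function.comp_apply, Fin.append_right]
        rw [hcomp]
        exact (hg w).1 hw i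
      · rw [Set.mem_setOf_eq, hq]
        simp only [Fin.append_left, Fin.append_right, Pi.add_apply]
        rw [hΛe w l]
        ring
      · funext i
        simp only [Fin.append_left]
    · rintro ⟨v, ⟨hv1, hv2⟩, rfl⟩
      refine ⟨v ∘ Fin.natAdd n, (hg _).2 fun i => ?_, ?_⟩
      · have := Set.mem_iInter₂.1 hv1 i (Finset.mem_univ _)
        rwa [Set.mem_setOf_eq, hgr] at this
      · funext l
        have h2 := Set.mem_iInter₂.1 hv2 l (Finset.mem_univ _)
        rw [Set.mem_setOf_eq, hq, sub_sub, sub_eq_zero] at h2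
        show (a₀ + Λ (v ∘ Fin.natAdd n)) l = v (Fin.castAdd N l)
        rw [h2, Pi.add_apply, hΛe]
        rfl
  rw [hSW]
  exact hW.image_castAdd

/-- **The boundary of a set with a psd lift lies on a real algebraic hypersurface** (the
qualitative content of [FawziEtAl2015, Prop. 5.12] / [GouveiaParriloThomas2013, Prop. 4.17],
UNCONDITIONAL: "by construction, this polynomial vanishes on the boundary of `C`"): for every
`C ⊆ ℝⁿ` with a psd lift there is a nonzero polynomial vanishing on `frontier C`. The DEGREE bound
`k^{O(k²n)}` is `FawziEtAl2015_prop512` (below, modulo Renegar's quantifier elimination).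
[cite: FawziEtAl2015, Prop. 5.12 (p16)] -/
theorem HasPsdLift.exists_ne_zero_eval_eq_zero_of_mem_frontier {S : Set (Fin n → ℝ)}
    (h : HasPsdLift S k) :
    ∃ P : MvPolynomial (Fin n) ℝ, P ≠ 0 ∧ ∀ y ∈ frontier S, eval y P = 0 :=
  h.isSemialgebraic.exists_frontier_subset_zeroLocus

end Semialgebraic

/-! ### §4 Proposition 5.12 and Corollary 5.13 modulo Renegar's quantifier elimination -/

section DegreeBound

variable {n k : ℕ}

open Literature.AlgebraicGeometry.RealAlgebraic (Renegar1992_qeExistentialBlock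
  exists_frontier_polynomial_of_qe exists_frontier_subset_zeroLocus_of_sign_determined)

/-- Substituting polynomials of total degree `≤ 1` does not raise the total degree. [folklore] -/
private theorem totalDegree_aeval_le_of_forall_le_one {σ τ : Type*} (θ : σ → MvPolynomial τ ℝ)
    (hθ : ∀ s, (θ s).totalDegree ≤ 1) (F : MvPolynomial σ ℝ) :
    (aeval θ F).totalDegree ≤ F.totalDegree := by
  classical
  conv_lhs => rw [F.as_sum]
  rw [map_sum]
  refine (totalDegree_finsetSum _ _).trans (Finset.sup_le fun d hd => ?_)
  rw [aeval_monomial, algebraMap_eq]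
  refine (totalDegree_mul _ _).trans ?_
  rw [totalDegree_C, zero_add, Finsupp.prod]
  refine (totalDegree_finsetProd _ _).trans ?_
  calc ∑ i ∈ d.support, (θ i ^ d i).totalDegree
      ≤ ∑ i ∈ d.support, d i := Finset.sum_le_sum fun i _ =>
          (totalDegree_pow _ _).trans (by simpa using Nat.mul_le_mul_left (d i) (hθ i))
    _ ≤ F.totalDegree := by simpa [Finsupp.sum] using le_totalDegree hd

/-- A polynomial of total degree `≤ 1` is affine: `p = p(0) + Σ_i (coeff_{e_i} p) X_i`. [folklore] -/
private theorem eq_C_add_sum_C_mul_X_of_totalDegree_le_one {σ : Type*} [Fintype σ] [DecidableEq σ]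
    {p : MvPolynomial σ ℝ} (hp : p.totalDegree ≤ 1) :
    p = C (coeff 0 p) + ∑ i, C (coeff (Finsupp.single i 1) p) * X i := by
  ext d
  rw [coeff_add, coeff_C, coeff_sum]
  simp only [coeff_C_mul, coeff_X, mul_ite, mul_one, mul_zero]
  by_cases h0 : d = 0
  · subst h0
    rw [if_pos rfl, Finset.sum_eq_zero fun i _ => if_neg (Finsupp.single_ne_zero.mpr one_ne_zero),
      add_zero]
  rw [if_neg (Ne.symm h0), zero_add]
  by_cases h1 : d.degree = 1
  · have hm : d ∈ Set.range fun i : σ => Finsupp.single i 1 := by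
      rw [Finsupp.range_single_one]; exact h1
    obtain ⟨j, hj⟩ := Set.mem_range.mp hm
    subst hj
    rw [Finset.sum_eq_single j (fun i _ hij => if_neg fun h => hij
      ((Finsupp.single_left_inj one_ne_zero).mp h)) (fun h => absurd (Finset.mem_univ _) h),
      if_pos rfl]
  · have hm : coeff d p = 0 := by
      rw [← notMem_support_iff]
      intro hmem
      have hle : d.degree ≤ 1 := (le_totalDegree hmem).trans hp
      have hne : d.degree ≠ 0 := fun h => h0 ((Finsupp.degree_eq_zero_iff d).mp h)
      omega
    rw [hm]
    exact (Finset.sum_eq_zero fun i _ =>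
      if_neg fun h => h1 (by rw [← h, Finsupp.degree_single])).symm

/-- The case `k = 1` of the degree bound: if `C₀ = {x ∈ ℝ¹ : ∃ u, g(x,u) ≥ 0}` with `g` of degree
`≤ 1` then some nonzero polynomial of degree `≤ 1` vanishes on `frontier C₀` (`C₀` is empty, the
line, or a closed ray). [folklore] -/
private theorem exists_frontier_polynomial_of_affine {m : ℕ}
    (G : MvPolynomial (Fin (1 + m)) ℝ) (hG : G.totalDegree ≤ 1) :
    ∃ H : MvPolynomial (Fin 1) ℝ, H ≠ 0 ∧ H.totalDegree ≤ 1 ∧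
      ∀ x ∈ frontier {x : Fin 1 → ℝ | ∃ u : Fin m → ℝ, 0 ≤ eval (Fin.append x u) G},
        eval x H = 0 := by
  classical
  set γ : ℝ := coeff 0 G with hγ
  set c : Fin (1 + m) → ℝ := fun r => coeff (Finsupp.single r 1) G with hc
  have hGeval : ∀ (x : Fin 1 → ℝ) (u : Fin m → ℝ), eval (Fin.append x u) G =
      γ + c (Fin.castAdd m 0) * x 0 + ∑ j, c (Fin.natAdd 1 j) * u j := by
    intro x u
    conv_lhs => rw [eq_C_add_sum_C_mul_X_of_totalDegree_le_one hG]
    simp only [map_add, map_sum, map_mul, eval_C, eval_X, Fin.sum_univ_add, Fin.append_left,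
      Fin.append_right, Fin.sum_univ_one]
    simp only [hγ, hc]
    ring
  by_cases hdep : ∃ j, c (Fin.natAdd 1 j) ≠ 0
  · -- `G` depends on `u`: every `x` is feasible, the boundary is empty
    obtain ⟨j, hj⟩ := hdep
    refine ⟨1, one_ne_zero, by simp, fun x hx => ?_⟩
    have huniv : {x : Fin 1 → ℝ | ∃ u : Fin m → ℝ, 0 ≤ eval (Fin.append x u) G} = Set.univ := by
      refine Set.eq_univ_of_forall fun x => ?_
      refine ⟨Pi.single j (-(γ + c (Fin.castAdd m 0) * x 0) / c (Fin.natAdd 1 j)), ?_⟩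
      rw [hGeval]
      have hsum : ∑ j', c (Fin.natAdd 1 j') *
          (Pi.single j (-(γ + c (Fin.castAdd m 0) * x 0) / c (Fin.natAdd 1 j)) : Fin m → ℝ) j'
          = -(γ + c (Fin.castAdd m 0) * x 0) := by
        rw [Finset.sum_eq_single j (fun j' _ hj' => by rw [Pi.single_eq_of_ne hj', mul_zero])
          (fun h => absurd (Finset.mem_univ _) h), Pi.single_eq_same, mul_div_cancel₀ _ hj]
      rw [hsum]
      linarith
    rw [huniv, frontier_univ] at hx
    exact hx.elim
  · -- `G` does not depend on `u`: `C₀ = {γ + c₀ x ≥ 0}` is cut out by one affine polynomial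
    push Not at hdep
    let H₁ : MvPolynomial (Fin 1) ℝ := C γ + C (c (Fin.castAdd m 0)) * X 0
    have hH₁ : ∀ x : Fin 1 → ℝ, eval x H₁ = γ + c (Fin.castAdd m 0) * x 0 := by
      intro x; simp [H₁]
    have hset : ∀ (x : Fin 1 → ℝ), (∃ u : Fin m → ℝ, 0 ≤ eval (Fin.append x u) G) ↔
        0 ≤ eval x H₁ := by
      intro x
      have hval : ∀ u : Fin m → ℝ, eval (Fin.append x u) G = eval x H₁ := by
        intro u
        rw [hGeval, hH₁, Finset.sum_eq_zero fun j _ => by rw [hdep j, zero_mul], add_zero]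
      constructor
      · rintro ⟨u, hu⟩; rwa [hval u] at hu
      · intro h; exact ⟨fun _ => 0, by rwa [hval]⟩
    obtain ⟨H, hH0, hHdeg, hH⟩ := exists_frontier_subset_zeroLocus_of_sign_determined
      (fun _ : Unit => H₁) (S := {x : Fin 1 → ℝ | ∃ u : Fin m → ℝ, 0 ≤ eval (Fin.append x u) G})
      (by
        intro x y hxy
        simp only [Set.mem_setOf_eq]
        rw [hset x, hset y]
        have h := hxy ()
        constructor
        · intro hx
          rcases hx.eq_or_lt with h0 | hpos
          · have : SignType.sign (eval y H₁) = 0 := by rw [← h, ← h0, sign_zero]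
            exact (sign_eq_zero_iff.1 this).symm.le
          · have : SignType.sign (eval y H₁) = 1 := by rw [← h, sign_pos hpos]
            exact (sign_eq_one_iff.1 this).le
        · intro hy
          rcases hy.eq_or_lt with h0 | hpos
          · have : SignType.sign (eval x H₁) = 0 := by rw [h, ← h0, sign_zero]
            exact (sign_eq_zero_iff.1 this).symm.le
          · have : SignType.sign (eval x H₁) = 1 := by rw [h, sign_pos hpos]
            exact (sign_eq_one_iff.1 this).le)
    refine ⟨H, hH0, hHdeg.trans ?_, hH⟩
    simp only [Finset.univ_unique, Finset.sum_singleton]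
    refine (totalDegree_add _ _).trans (max_le (by simp) ((totalDegree_mul _ _).trans ?_))
    rw [totalDegree_C, zero_add]
    exact (totalDegree_X (R := ℝ) (0 : Fin 1)).le

/-- **FGPRT Proposition 5.12 from Renegar's quantifier elimination** (the printed proof, with the
coefficient sign test for `Y ⪰ 0` in place of the Renegar derivatives of Theorem 5.10 — so no
reduction to a proper lift is needed — and Theorem 5.11 = `Renegar1992_qeExistentialBlock`):
`C = a₀ + {x : ∃ u ∈ ℝ^m, g_i(x,u) ≥ 0 (i < k)}` with `m ≤ k² + 1`, `deg g_i ≤ k`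
(`HasPsdLift.exists_eq_image_projection`), so the boundary of `C` lies in the zero set of a nonzero
polynomial of degree `≤ (k²)^{K(n+2)m} ≤ k^{12K k² n}` (`exists_frontier_polynomial_of_qe`); the
cases `n = 0` and `k = 1` (a ray or a line) are direct. Hence `FawziEtAl2015_prop512` holds with
`c = 12K + 1`. [cite: FawziEtAl2015, Prop. 5.12 (p16)] -/
theorem FawziEtAl2015_prop512_of_qe (hqe : Renegar1992_qeExistentialBlock) :
    FawziEtAl2015_prop512 := by
  classical
  obtain ⟨K, hK⟩ := exists_frontier_polynomial_of_qe hqe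
  refine ⟨(12 * K + 1 : ℕ), by positivity, fun n k S _ hint hlift => ?_⟩
  rcases Nat.eq_zero_or_pos n with rfl | hn
  · -- `n = 0`: `C = ℝ⁰` has empty boundary
    refine ⟨1, one_ne_zero, fun y hy => ?_, ?_⟩
    · have hS : S = Set.univ := Subsingleton.eq_univ_of_nonempty (hint.mono interior_subset)
      rw [hS, frontier_univ] at hy
      exact hy.elim
    · simp only [totalDegree_one, CharP.cast_eq_zero]
      exact Real.rpow_nonneg (Nat.cast_nonneg k) _
  obtain ⟨m, a₀, g, hm1, hmk, hnk, hgdeg, hS⟩ := hlift.exists_eq_image_projection hint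
  have hk1 : 1 ≤ k := by
    rcases Nat.eq_zero_or_pos k with rfl | hk
    · simp at hnk; omega
    · exact hk
  set C₀ : Set (Fin n → ℝ) := {x | ∃ u : Fin m → ℝ, ∀ i, 0 ≤ eval (Fin.append x u) (g i)}
    with hC₀
  -- a nonzero polynomial of the right degree vanishing on the boundary of `C₀`
  have key : ∃ H : MvPolynomial (Fin n) ℝ, H ≠ 0 ∧ (∀ x ∈ frontier C₀, eval x H = 0) ∧
      (H.totalDegree : ℝ) ≤ (k : ℝ) ^ (((12 * K + 1 : ℕ) : ℝ) * (k : ℝ) ^ 2 * n) := by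
    rcases lt_or_ge k 2 with hk2 | hk2
    · -- `k = 1`, hence `n = 1`
      obtain rfl : k = 1 := by omega
      obtain rfl : n = 1 := by omega
      have hC₀' : C₀ = {x : Fin 1 → ℝ | ∃ u : Fin m → ℝ, 0 ≤ eval (Fin.append x u) (g 0)} := by
        rw [hC₀]
        ext x
        simp only [Set.mem_setOf_eq, Fin.forall_fin_one]
      obtain ⟨H, hH0, hHdeg, hH⟩ := exists_frontier_polynomial_of_affine (g 0) (hgdeg 0)
      refine ⟨H, hH0, fun x hx => hH x (hC₀' ▸ hx), ?_⟩
      rw [Nat.cast_one, Real.one_rpow]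
      exact_mod_cast hHdeg
    · obtain ⟨H, hH0, hHdeg, hH⟩ := hK n m k k hn hm1 hk1 hk2 g hgdeg
      refine ⟨H, hH0, hH, ?_⟩
      have h1 : H.totalDegree ≤ k ^ (12 * K * k ^ 2 * n) := by
        refine hHdeg.trans ?_
        rw [← sq, ← pow_mul]
        apply Nat.pow_le_pow_right hk1
        have h3 : (n + 2) * m ≤ 3 * n * (2 * k ^ 2) := by nlinarith [hm1, hmk, hn, hk1]
        nlinarith [h3]
      calc (H.totalDegree : ℝ) ≤ ((k ^ (12 * K * k ^ 2 * n) : ℕ) : ℝ) := by exact_mod_cast h1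
        _ = (k : ℝ) ^ (((12 * K * k ^ 2 * n : ℕ) : ℝ)) := by
            rw [Nat.cast_pow, Real.rpow_natCast]
        _ ≤ (k : ℝ) ^ (((12 * K + 1 : ℕ) : ℝ) * (k : ℝ) ^ 2 * n) := by
            apply Real.rpow_le_rpow_of_exponent_le (by exact_mod_cast hk1)
            push_cast
            have hk0 : (0 : ℝ) ≤ (k : ℝ) ^ 2 * n := by positivity
            nlinarith [hk0]
  obtain ⟨H, hH0, hH, hHdeg⟩ := key
  -- translate back by `a₀`
  let θ : Fin n → MvPolynomial (Fin n) ℝ := fun l => X l - C (a₀ l)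
  have hθ : ∀ l, (θ l).totalDegree ≤ 1 := fun l =>
    (totalDegree_sub _ _).trans (max_le (totalDegree_X (R := ℝ) l).le (by simp))
  have heval : ∀ y : Fin n → ℝ, eval y (aeval θ H) = eval (fun l => y l - a₀ l) H := by
    intro y
    rw [MvPolynomial.aeval_eq_bind₁, show eval y = eval₂Hom (RingHom.id ℝ) y from rfl,
      MvPolynomial.eval₂Hom_bind₁]
    simp only [θ, map_sub, eval₂Hom_X', eval₂Hom_C, RingHom.id_apply]
    rfl
  have hfr : frontier S = (Homeomorph.addLeft a₀) '' frontier C₀ := by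
    rw [Homeomorph.image_frontier, hS]
    rfl
  refine ⟨aeval θ H, ?_, ?_, ?_⟩
  · intro h0
    apply hH0
    apply MvPolynomial.funext
    intro z
    have h1 := heval (z + a₀)
    rw [h0, map_zero] at h1
    have h2 : (fun l => (z + a₀) l - a₀ l) = z := by
      funext l; simp
    rw [h2] at h1
    rw [map_zero, ← h1]
  · intro y hy
    rw [hfr] at hy
    obtain ⟨x, hx, rfl⟩ := hy
    rw [heval]
    have : (fun l => (Homeomorph.addLeft a₀) x l - a₀ l) = x := by
      funext l; simp
    rw [this]
    exact hH x hx
  · exact le_trans (by exact_mod_cast totalDegree_aeval_le_of_forall_le_one θ hθ H) hHdeg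

/-- **FGPRT Corollary 5.13 from Renegar's quantifier elimination**: a full-dimensional polytope
whose slack matrix has psd rank `k` has at most `k^{O(k²n)}` facets — the tree's
`FawziEtAl2015_cor513_of_prop512` (proved in `PolytopePsdRankLowerBound.lean`) composed with
`FawziEtAl2015_prop512_of_qe`. [cite: FawziEtAl2015, Cor. 5.13 (p16)] -/
theorem FawziEtAl2015_cor513_of_qe (hqe : Renegar1992_qeExistentialBlock) :
    FawziEtAl2015_cor513 :=
  FawziEtAl2015_cor513_of_prop512 (FawziEtAl2015_prop512_of_qe hqe)

end DegreeBound

end Literature.Combinatorics.Optimization
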